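import Literature.NumberTheory.EllipticCurves.AnalyticRankLSeriesSummableProofs
import Mathlib.NumberTheory.LSeries.Deriv
import Mathlib.NumberTheory.LSeries.Convolution
import Mathlib.Analysis.Normed.Group.FunctionSeries
import Mathlib.Analysis.Complex.ReImTopology
import Mathlib.Analysis.Complex.Convex
import HarnessLib

/-!
# The value `L(W, 1)` of the tree's entire `L`-function, without a continuation hypothesis

Proof file (theorems only, no definitions) next to
`Literature.NumberTheory.EllipticCurves.AnalyticRank`, whose `WeierstrassCurve.entireLFunction W`
is *the* entire continuation of Mathlib's `L`-series `W.LSeries` when one exists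
(`W.HasEntireLFunction`) and — documented junk value — `W.LSeries` itself otherwise. Statements of
the tree of the form "`L(E, 1) ≠ 0 ⇒ …`" (bsd.S28 and its leaves: Coates–Wiles, Rubin,
Burungale–Flach) read `L(E, 1)` as `W.entireLFunction 1`, and every reduction that moves the
hypothesis `L(E/ℚ, 1) ≠ 0` to the CM field, `L(E_K/K, 1) = L(E/ℚ, 1)² ≠ 0` (Deuring's
`L(E_K/K, s) = L(E/ℚ, s)²`, Rubin 1987 (0.1)), has so far needed a *continuation leaf* — modularity
(`WeierstrassCurve.hasEntireLFunction_rat`) or Deuring–Hecke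
(`hasEntireLFunction_of_j_mem_maximalCMJInvariants`) — only to know that `W.entireLFunction` is a
genuine continuation (`Literature.NumberTheory.EllipticCurves.entireLFunction_one_eq_sq_of_LFunction_eq_mul_self`,
hypothesis `W.HasEntireLFunction`).

This file shows that **no continuation hypothesis is needed for that step**:

* `entireLFunction_one_eq_sq_of_LFunction_eq_mul_self_of_ne_zero`: if
  `W'.LFunction = W.LFunction * W.LFunction` (formal Dirichlet series) and `W.entireLFunction 1 ≠ 0`,
  then `W'.entireLFunction 1 = (W.entireLFunction 1)²`; hence
  `entireLFunction_one_ne_zero_of_LFunction_eq_mul_self`: `W'.entireLFunction 1 ≠ 0`.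

The proof is a case distinction which the definitions make exhaustive. If `L(W, s)` has an entire
continuation `f`, then `f²` continues `L(W', s)` and the claim is the old lemma. If not,
`W.entireLFunction = W.LSeries` by definition, so `L(W, 1) ≠ 0` says that the *series*
`∑ aₙ n⁻¹` has a non-zero unconditional sum, in particular converges absolutely
(`LSeriesSummable_of_LSeries_ne_zero`); then `∑ bₙ n⁻ˢ`, `b = a ⋆ a`, converges absolutely on
`Re s ≥ 1`, where it is continuous (`continuousOn_LSeries_of_LSeriesSummable`) and equals
`(∑ aₙ n⁻ˢ)²`, and is holomorphic on `Re s > 1`. Whether or not `L(W', s)` has an entire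
continuation `g`, the value `W'.entireLFunction 1` is the series value
(`WeierstrassCurve.entireLFunction_one_eq_LSeries_one`): if `g` exists it agrees with the series on
`Re s > 3/2`, hence on `Re s > 1` (identity theorem), hence at `s = 1` (both sides have a limit
along `s → 1`, `Re s > 1`). So in every case `W'.entireLFunction 1 = (W.entireLFunction 1)²`.

Consequence (recorded in the CM files, not here): the Deuring–Hecke continuation leaf drops out of
the trust base of `BurungaleFlach2024_finite_primary_cmField`, of the `Ш` part of bsd.S28
(`shaFinite_of_hasCM_of_L_one_ne_zero`) and of every other statement that uses the continuation
only through `L(E_K/K, 1) = L(E/ℚ, 1)² ≠ 0`.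

## References

* J. H. Silverman, *The Arithmetic of Elliptic Curves*, 2nd ed. (2009), App. C §16 (absolute
  convergence for `Re s > 3/2`, through `WeierstrassCurve.LSeriesSummable_of_lt_re_holds`).
  [SilvermanAEC2009]
* standard facts on Dirichlet series (Mathlib `LSeries_convolution'`, `LSeries_analyticOnNhd`) and
  the identity theorem (Mathlib `AnalyticOnNhd.eqOn_of_preconnected_of_eventuallyEq`).

## Design

General Dirichlet-series lemmas and the square lemma live in
`namespace Literature.NumberTheory.EllipticCurves` (next to the lemma they sharpen); the two
statements about `W.entireLFunction` are deliberate dot-notation extensions of Mathlib's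
`WeierstrassCurve`, like the API of `AnalyticRank.lean`. Imports are kept light (no CM files) so
that any consumer can use the lemma.
-/

noncomputable section

open scoped Classical LSeries.notation

open Complex Filter Topology Set

namespace Literature.NumberTheory.EllipticCurves

/-! ### Dirichlet series at a point of absolute convergence -/

/-- A non-zero value of Mathlib's `LSeries f s = ∑' n, term f s n` forces (unconditional, i.e.
absolute) summability of the series at `s`: the sum of a non-summable family is `0` by
convention. [folklore] -/
theorem LSeriesSummable_of_LSeries_ne_zero {f : ℕ → ℂ} {s : ℂ} (h : LSeries f s ≠ 0) :
    LSeriesSummable f s := by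
  by_contra hs
  exact h (tsum_eq_zero_of_not_summable hs)

/-- A Dirichlet series which converges absolutely at `s₀` is continuous on the closed half-plane
`Re s ≥ Re s₀` (Weierstrass `M`-test with the majorant `‖aₙ‖ n^{-Re s₀}`). [folklore] -/
theorem continuousOn_LSeries_of_LSeriesSummable {f : ℕ → ℂ} {s₀ : ℂ} (h : LSeriesSummable f s₀) :
    ContinuousOn (LSeries f) {s : ℂ | s₀.re ≤ s.re} := by
  change ContinuousOn (fun s ↦ ∑' n, LSeries.term f s n) {s : ℂ | s₀.re ≤ s.re}
  refine continuousOn_tsum (fun n ↦ ?_) h.norm fun n s hs ↦ LSeries.norm_term_le_of_re_le_re f hs n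
  rcases eq_or_ne n 0 with rfl | hn
  · simp only [LSeries.term_zero]
    exact continuousOn_const
  · simp only [LSeries.term_of_ne_zero hn]
    have hn' : (n : ℂ) ≠ 0 := Nat.cast_ne_zero.mpr hn
    exact (continuous_const.div (continuous_id.const_cpow (Or.inl hn'))
      fun s ↦ by simp [cpow_eq_zero_iff, hn']).continuousOn

/-- A Dirichlet series which converges absolutely at `s₀` is holomorphic on the open half-plane
`Re s > Re s₀` (Mathlib: holomorphic to the right of the abscissa of absolute convergence, which
is `≤ Re s₀`). [folklore] -/
theorem analyticOnNhd_LSeries_of_LSeriesSummable {f : ℕ → ℂ} {s₀ : ℂ} (h : LSeriesSummable f s₀) :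
    AnalyticOnNhd ℂ (LSeries f) {s : ℂ | s₀.re < s.re} := by
  refine (LSeries_analyticOnNhd f).mono fun s hs ↦ ?_
  exact lt_of_le_of_lt h.abscissaOfAbsConv_le (by exact_mod_cast hs)

/-- The coercion to `ℂ` of a product of `ℤ`-valued arithmetic functions is the Dirichlet
convolution of the coercions (bookkeeping for `WeierstrassCurve.LSeries`, which is the `L`-series
of `(↑) ∘ W.LFunction`). [folklore] -/
theorem intCoe_comp_mul_eq_convolution (f g : ArithmeticFunction ℤ) :
    ((↑) ∘ ⇑(f * g) : ℕ → ℂ) = ((↑) ∘ f : ℕ → ℂ) ⍟ ((↑) ∘ g : ℕ → ℂ) := by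
  have h1 : ((↑) ∘ ⇑f : ℕ → ℂ) = ⇑(f : ArithmeticFunction ℂ) := rfl
  have h2 : ((↑) ∘ ⇑g : ℕ → ℂ) = ⇑(g : ArithmeticFunction ℂ) := rfl
  have h3 : ((↑) ∘ ⇑(f * g) : ℕ → ℂ) = ⇑((f * g : ArithmeticFunction ℤ) : ArithmeticFunction ℂ) :=
    rfl
  rw [h3, ArithmeticFunction.intCoe_mul, ← ArithmeticFunction.coe_mul, ← h1, ← h2]

end Literature.NumberTheory.EllipticCurves

namespace WeierstrassCurve

open Literature.NumberTheory.EllipticCurves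

variable {K : Type*} [Field K] [NumberField K] (W : WeierstrassCurve K)

/-- The junk branch of `WeierstrassCurve.entireLFunction` made explicit: if `L(W, s)` has no
entire continuation, `W.entireLFunction` *is* the `L`-series `W.LSeries` (by definition,
`AnalyticRank.lean`). Deliberate dot-notation extension of Mathlib's `WeierstrassCurve`.
[folklore] -/
theorem entireLFunction_eq_LSeries_of_not_hasEntireLFunction (h : ¬ W.HasEntireLFunction) :
    W.entireLFunction = W.LSeries := by
  unfold entireLFunction
  rw [dif_neg]
  exact h

/-- **If `∑ aₙ(W) n⁻¹` converges absolutely, then `L(W, 1)` in the tree's sense is its sum** —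
with or without an entire continuation. If `L(W, s)` has an entire continuation `g`
(`= W.entireLFunction`), then `g` and the series are both holomorphic on `Re s > 1` and agree on
`Re s > 3/2`, hence on `Re s > 1` (identity theorem on the convex half-plane), and both tend to
their value at `1` along `s → 1`, `Re s > 1` (the series being continuous on `Re s ≥ 1`), so
`g 1 = ∑ aₙ n⁻¹` by uniqueness of limits; if not, `W.entireLFunction = W.LSeries` by definition.
Deliberate dot-notation extension of Mathlib's `WeierstrassCurve`. [folklore] -/
theorem entireLFunction_one_eq_LSeries_one
    (h : LSeriesSummable ((↑) ∘ W.LFunction : ℕ → ℂ) 1) :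
    W.entireLFunction 1 = W.LSeries 1 := by
  by_cases hW : W.HasEntireLFunction
  · have hLdef : W.LSeries = LSeries ((↑) ∘ W.LFunction : ℕ → ℂ) := rfl
    set U : Set ℂ := {s : ℂ | (1 : ℂ).re < s.re} with hU_def
    have hUc : IsPreconnected U := by
      rw [hU_def, one_re]
      exact (convex_halfSpace_re_gt 1).isPreconnected
    have h2U : (2 : ℂ) ∈ U := by simp [hU_def]
    have hF : AnalyticOnNhd ℂ W.LSeries U := by
      rw [hLdef]
      exact analyticOnNhd_LSeries_of_LSeriesSummable h
    have hg : AnalyticOnNhd ℂ W.entireLFunction U :=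
      (W.differentiable_entireLFunction hW).differentiableOn.analyticOnNhd
        (isOpen_lt continuous_const continuous_re)
    have hev : W.entireLFunction =ᶠ[𝓝 (2 : ℂ)] W.LSeries := by
      have hopen : IsOpen {s : ℂ | (3 / 2 : ℝ) < s.re} :=
        isOpen_lt continuous_const continuous_re
      filter_upwards [hopen.mem_nhds (show (3 / 2 : ℝ) < (2 : ℂ).re by norm_num)] with s hs
      exact W.entireLFunction_eq_LSeries hW hs
    have hEq : EqOn W.entireLFunction W.LSeries U :=
      hg.eqOn_of_preconnected_of_eventuallyEq hF hUc h2U hev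
    haveI : (𝓝[U] (1 : ℂ)).NeBot := by
      apply mem_closure_iff_nhdsWithin_neBot.mp
      rw [hU_def, one_re, closure_setOf_lt_re]
      simp
    have t1 : Tendsto W.entireLFunction (𝓝[U] 1) (𝓝 (W.entireLFunction 1)) :=
      (W.differentiable_entireLFunction hW).continuous.continuousAt.continuousWithinAt
    have t2 : Tendsto W.LSeries (𝓝[U] 1) (𝓝 (W.LSeries 1)) := by
      have hc : ContinuousWithinAt W.LSeries {s : ℂ | (1 : ℂ).re ≤ s.re} 1 := by
        rw [hLdef]
        exact continuousOn_LSeries_of_LSeriesSummable h 1 (by simp)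
      refine hc.mono ?_
      rw [hU_def]
      exact fun s (hs : (1 : ℂ).re < s.re) ↦ show (1 : ℂ).re ≤ s.re from hs.le
    exact tendsto_nhds_unique_of_eventuallyEq t1 t2 hEq.eventuallyEq_nhdsWithin
  · rw [W.entireLFunction_eq_LSeries_of_not_hasEntireLFunction hW]

end WeierstrassCurve

namespace Literature.NumberTheory.EllipticCurves

open WeierstrassCurve

/-! ### `L(W', 1) = L(W, 1)²` from `L(W', s) = L(W, s)²`, unconditionally -/

/-- **`L(W', 1) = L(W, 1)²` without a continuation hypothesis.** Let `W`, `W'` be Weierstrass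
curves over number fields with `W'.LFunction = W.LFunction * W.LFunction` (formal Dirichlet
series; e.g. `W' = E_K` for a CM curve `E/ℚ` and its CM field `K`, Deuring) and suppose
`L(W, 1) ≠ 0` in the tree's sense (`W.entireLFunction 1 ≠ 0`). Then
`W'.entireLFunction 1 = (W.entireLFunction 1)²`. Cases: if `L(W, s)` has an entire continuation
`f`, then `f²` is one of `L(W', s)` (the series multiply on `Re s > 3/2`,
`WeierstrassCurve.LSeriesSummable_of_lt_re_holds`) and `W'.entireLFunction = f²` by uniqueness
(this is `entireLFunction_one_eq_sq_of_LFunction_eq_mul_self`); if not, `W.entireLFunction` is the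
series `∑ aₙ n⁻ˢ` itself, `L(W, 1) ≠ 0` makes it absolutely convergent at `s = 1`
(`LSeriesSummable_of_LSeries_ne_zero`), so `∑ bₙ n⁻ˢ`, `b = a ⋆ a`, converges absolutely at `1`
with sum `(∑ aₙ n⁻¹)²` (`LSeries_convolution'`), and that sum is `W'.entireLFunction 1`
(`WeierstrassCurve.entireLFunction_one_eq_LSeries_one`). Sharpens
`entireLFunction_one_eq_sq_of_LFunction_eq_mul_self` (hypothesis `W.HasEntireLFunction`).
[folklore] -/
theorem entireLFunction_one_eq_sq_of_LFunction_eq_mul_self_of_ne_zero {K₀ K : Type*} [Field K₀]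
    [NumberField K₀] [Field K] [NumberField K] {W : WeierstrassCurve K₀} {W' : WeierstrassCurve K}
    (h : W'.LFunction = W.LFunction * W.LFunction) (hL : W.entireLFunction 1 ≠ 0) :
    W'.entireLFunction 1 = W.entireLFunction 1 ^ 2 := by
  have hconv : ((↑) ∘ W'.LFunction : ℕ → ℂ) =
      ((↑) ∘ W.LFunction : ℕ → ℂ) ⍟ ((↑) ∘ W.LFunction : ℕ → ℂ) := by
    rw [h]
    exact intCoe_comp_mul_eq_convolution _ _
  have hL'def : W'.LSeries = LSeries ((↑) ∘ W'.LFunction : ℕ → ℂ) := rfl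
  have hLdef : W.LSeries = LSeries ((↑) ∘ W.LFunction : ℕ → ℂ) := rfl
  by_cases hW : W.HasEntireLFunction
  · -- `f²` is an entire continuation of `L(W', s)`
    set g : ℂ → ℂ := fun s ↦ W.entireLFunction s ^ 2 with hg_def
    have hg : g ∈ W'.entireContinuations := by
      refine ⟨(W.differentiable_entireLFunction hW).pow 2, fun s hs ↦ ?_⟩
      rw [hg_def]
      dsimp only
      rw [W.entireLFunction_eq_LSeries hW hs, hL'def, hconv,
        LSeries_convolution' (W.LSeriesSummable_of_lt_re_holds hs)
          (W.LSeriesSummable_of_lt_re_holds hs), sq, hLdef]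
    have hne : (W'.entireContinuations).Nonempty := ⟨g, hg⟩
    rw [W'.subsingleton_entireContinuations (W'.entireLFunction_mem hne) hg]
  · -- no continuation: everything is a convergent series at `s = 1`
    have hWL : W.entireLFunction = W.LSeries :=
      W.entireLFunction_eq_LSeries_of_not_hasEntireLFunction hW
    rw [hWL, hLdef] at hL ⊢
    have hs : LSeriesSummable ((↑) ∘ W.LFunction : ℕ → ℂ) 1 := LSeriesSummable_of_LSeries_ne_zero hL
    have hs' : LSeriesSummable ((↑) ∘ W'.LFunction : ℕ → ℂ) 1 := by
      rw [hconv]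
      exact hs.convolution hs
    rw [W'.entireLFunction_one_eq_LSeries_one hs', hL'def, hconv, LSeries_convolution' hs hs, sq]

/-- Hence **`L(W, 1) ≠ 0 ⇒ L(W', 1) ≠ 0` whenever `L(W', s) = L(W, s)²` formally**, with no
continuation hypothesis — the form in which Deuring's `L(E_K/K, s) = L(E/ℚ, s)²` feeds Rubin's
theorems over the CM field `K` from `L(E/ℚ, 1) ≠ 0`. [folklore] -/
theorem entireLFunction_one_ne_zero_of_LFunction_eq_mul_self {K₀ K : Type*} [Field K₀]
    [NumberField K₀] [Field K] [NumberField K] {W : WeierstrassCurve K₀} {W' : WeierstrassCurve K}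
    (h : W'.LFunction = W.LFunction * W.LFunction) (hL : W.entireLFunction 1 ≠ 0) :
    W'.entireLFunction 1 ≠ 0 := by
  rw [entireLFunction_one_eq_sq_of_LFunction_eq_mul_self_of_ne_zero h hL]
  exact pow_ne_zero 2 hL

end Literature.NumberTheory.EllipticCurves

end
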